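import Literature.Analysis.FluidPDE.TypeIAncientMild
import HarnessLib

/-!
# Powers of a linear isometry of `ℝ³`: syndetic returns to the identity; iterated screw symmetry

Helper file (tools) for rung R8 `ScrewSymmetricLiouville` of LINE g9-β `filament_selection` on crux
stmt-NavierStokesRegularity-26567 (`NearExtremalTransiencePerFlow`); consumed by
`ExtremiserTransienceScrewSymmetricNearAxisVanishing.lean`, whose argument is summarised here.

Let `u ∈ A_C` (`IsTypeIAncientMild C u`) be symmetric under a screw motion `x ↦ L x + b`,
`L` a linear isometry with `L b = b`: `u t (L x + b) = L (u t x)` for all `t < 0`. Then for every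
`ε > 0` and every `D`, `√(−t)‖u(t, x)‖ ≤ ε` for all `t < T(ε, D)` and all `x` in the parabolic
neighbourhood `‖x‖ ≤ D √(−t)` of the origin (which lies on the screw axis).

Proof (KNSS 2009 §6 zoom-out, the tree's template `periodicBlowdownVanishing_axis`): violators
`(t_n, x_n)` with `‖x_n‖ ≤ D√(−t_n)`, `t_n → −∞`; the blow-downs
`v_n(s, y) = λ_n u(λ_n² s, x_n + λ_n y)`, `λ_n = √(−t_n)`, lie in `A_C`, have `‖v_n(−1, 0)‖ > ε`
and are screw-symmetric WITH BOUNDED OFFSET: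
`v_n(s, L^k y + (L^k q_n − q_n) + (k/λ_n) b) = L^k v_n(s, y)`, `q_n = x_n/λ_n`, `‖q_n‖ ≤ D`.
Returns of `k ↦ L^k` to the identity are SYNDETIC (bounded gaps; total boundedness of the set of
powers in `(EuclideanSpace ℝ (Fin 3)) →L[ℝ] (EuclideanSpace ℝ (Fin 3))`, centres in the set, isometry invariance of the operator norm — no
rational/irrational case split), so for every `θ > 0` there are exponents `k_n` with `L^{k_n} → 1`
and `k_n/λ_n → θ`; hence an F3-limit `w ∈ A_C` of the `v_n` is invariant under the whole line
`ℝ b`, and vanishes by the PROVED `KNSS2009_typeI_rate_liouville_holds` (after rotating `b` onto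
the `x₂`-axis and shifting time) — contradicting `‖w(−1, 0)‖ ≥ ε`.
[cite: KochNadirashviliSereginSverak2009, proof of Thm 6.2 (arXiv:0709.3599 p. 13)]
-/

noncomputable section

set_option linter.dupNamespace false

open Set Function Filter Metric
open scoped Topology

namespace Summit.NavierStokesRegularity.NavierStokesRegularity.Theorems.ScrewSymmetricLiouville

/-! ### Iterates of a linear isometry -/

/-- Iterates of a linear isometry preserve distances. -/
theorem norm_iterate_sub (L : (EuclideanSpace ℝ (Fin 3)) ≃ₗᵢ[ℝ] (EuclideanSpace ℝ (Fin 3))) (k : ℕ) (a c : (EuclideanSpace ℝ (Fin 3))) :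
    ‖(⇑L)^[k] a - (⇑L)^[k] c‖ = ‖a - c‖ := by
  induction k generalizing a c with
  | zero => simp
  | succ k ih =>
    rw [Function.iterate_succ_apply', Function.iterate_succ_apply', ← map_sub, L.norm_map, ih]

/-- Iterates of a linear isometry are additive. -/
theorem iterate_map_add (L : (EuclideanSpace ℝ (Fin 3)) ≃ₗᵢ[ℝ] (EuclideanSpace ℝ (Fin 3))) (k : ℕ) (a c : (EuclideanSpace ℝ (Fin 3))) :
    (⇑L)^[k] (a + c) = (⇑L)^[k] a + (⇑L)^[k] c := by
  induction k generalizing a c with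
  | zero => simp
  | succ k ih =>
    rw [Function.iterate_succ_apply', Function.iterate_succ_apply', Function.iterate_succ_apply', ih,
      map_add]

/-- Iterates of a linear isometry commute with scalars. -/
theorem iterate_map_smul (L : (EuclideanSpace ℝ (Fin 3)) ≃ₗᵢ[ℝ] (EuclideanSpace ℝ (Fin 3))) (k : ℕ) (r : ℝ) (a : (EuclideanSpace ℝ (Fin 3))) :
    (⇑L)^[k] (r • a) = r • (⇑L)^[k] a := by
  induction k generalizing a with
  | zero => simp
  | succ k ih =>
    rw [Function.iterate_succ_apply', Function.iterate_succ_apply', ih, L.map_smul]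

/-- Iterates of a linear isometry are subtractive. -/
theorem iterate_map_sub (L : (EuclideanSpace ℝ (Fin 3)) ≃ₗᵢ[ℝ] (EuclideanSpace ℝ (Fin 3))) (k : ℕ) (a c : (EuclideanSpace ℝ (Fin 3))) :
    (⇑L)^[k] (a - c) = (⇑L)^[k] a - (⇑L)^[k] c := by
  rw [sub_eq_add_neg, iterate_map_add, ← neg_one_smul ℝ c, iterate_map_smul, neg_one_smul,
    ← sub_eq_add_neg]

/-- `(L.toLinearIsometry ^ k).toContinuousLinearMap` acts as the `k`-th iterate of `L`. -/
@[simp] theorem toCLM_pow_apply (L : (EuclideanSpace ℝ (Fin 3)) ≃ₗᵢ[ℝ] (EuclideanSpace ℝ (Fin 3))) (k : ℕ) (x : (EuclideanSpace ℝ (Fin 3))) :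
    (L.toLinearIsometry ^ k).toContinuousLinearMap x = (⇑L)^[k] x := by
  simp only [LinearIsometry.coe_toContinuousLinearMap, LinearIsometry.coe_pow,
    LinearIsometryEquiv.coe_toLinearIsometry]

/-- The powers have operator norm at most one. -/
theorem norm_toCLM_pow_le (L : (EuclideanSpace ℝ (Fin 3)) ≃ₗᵢ[ℝ] (EuclideanSpace ℝ (Fin 3))) (k : ℕ) : ‖(L.toLinearIsometry ^ k).toContinuousLinearMap‖ ≤ 1 :=
  (L.toLinearIsometry ^ k).norm_toContinuousLinearMap_le

/-- Powers add under composition. -/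
theorem toCLM_pow_add (L : (EuclideanSpace ℝ (Fin 3)) ≃ₗᵢ[ℝ] (EuclideanSpace ℝ (Fin 3))) (i j : ℕ) :
    (L.toLinearIsometry ^ (i + j)).toContinuousLinearMap = ((L.toLinearIsometry ^ i).toContinuousLinearMap).comp ((L.toLinearIsometry ^ j).toContinuousLinearMap) := by
  ext1 x
  simp only [toCLM_pow_apply, ContinuousLinearMap.coe_comp, comp_apply, Function.iterate_add_apply]

/-- Isometry invariance of the distance between powers: `‖L^{i+j} − L^i‖ = ‖L^j − 1‖`. -/
theorem norm_toCLM_pow_add_sub (L : (EuclideanSpace ℝ (Fin 3)) ≃ₗᵢ[ℝ] (EuclideanSpace ℝ (Fin 3))) (i j : ℕ) :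
    ‖(L.toLinearIsometry ^ (i + j)).toContinuousLinearMap - (L.toLinearIsometry ^ i).toContinuousLinearMap‖ = ‖(L.toLinearIsometry ^ j).toContinuousLinearMap - 1‖ := by
  have h : (L.toLinearIsometry ^ (i + j)).toContinuousLinearMap - (L.toLinearIsometry ^ i).toContinuousLinearMap = ((L.toLinearIsometry ^ i).toContinuousLinearMap).comp ((L.toLinearIsometry ^ j).toContinuousLinearMap - 1) := by
    rw [ContinuousLinearMap.comp_sub, ← toCLM_pow_add, ContinuousLinearMap.one_def,
      ContinuousLinearMap.comp_id]
  rw [h]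
  exact (L.toLinearIsometry ^ i).norm_toContinuousLinearMap_comp

/-- Pointwise form of closeness to the identity. -/
theorem norm_iterate_sub_self_le (L : (EuclideanSpace ℝ (Fin 3)) ≃ₗᵢ[ℝ] (EuclideanSpace ℝ (Fin 3))) (k : ℕ) (x : (EuclideanSpace ℝ (Fin 3))) :
    ‖(⇑L)^[k] x - x‖ ≤ ‖(L.toLinearIsometry ^ k).toContinuousLinearMap - 1‖ * ‖x‖ := by
  have h := ((L.toLinearIsometry ^ k).toContinuousLinearMap - 1).le_opNorm x
  have e : ((L.toLinearIsometry ^ k).toContinuousLinearMap - 1) x = (⇑L)^[k] x - x := by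
    show (L.toLinearIsometry ^ k).toContinuousLinearMap x - x = _
    rw [toCLM_pow_apply]
  rwa [e] at h

/-! ### Syndetic returns of the powers of a linear isometry to the identity -/

/-- **Returns of `k ↦ L^k` to the identity have bounded gaps**: for every `ε > 0` there is `M`
such that every `k₀ ≥ M` has some `k ∈ [k₀ − M, k₀]` with `‖L^k − 1‖ < ε` (total boundedness of
the set of powers in the finite-dimensional space `(EuclideanSpace ℝ (Fin 3)) →L[ℝ] (EuclideanSpace ℝ (Fin 3))` with centres IN the set, and
`‖L^{k₀} − L^{i}‖ = ‖L^{k₀ − i} − 1‖`). [folklore] -/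
theorem exists_syndetic_return (L : (EuclideanSpace ℝ (Fin 3)) ≃ₗᵢ[ℝ] (EuclideanSpace ℝ (Fin 3))) {ε : ℝ} (hε : 0 < ε) :
    ∃ M : ℕ, ∀ k₀ : ℕ, M ≤ k₀ → ∃ k : ℕ, k₀ ≤ k + M ∧ k ≤ k₀ ∧ ‖(L.toLinearIsometry ^ k).toContinuousLinearMap - 1‖ < ε := by
  classical
  set f : ℕ → ((EuclideanSpace ℝ (Fin 3)) →L[ℝ] (EuclideanSpace ℝ (Fin 3))) := fun k => (L.toLinearIsometry ^ k).toContinuousLinearMap with hf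
  have hS : TotallyBounded (Set.range f) := by
    refine TotallyBounded.subset ?_ (isCompact_closedBall (0 : (EuclideanSpace ℝ (Fin 3)) →L[ℝ] (EuclideanSpace ℝ (Fin 3))) 1).totallyBounded
    rintro _ ⟨k, rfl⟩
    rw [mem_closedBall, dist_zero_right]
    exact norm_toCLM_pow_le L k
  obtain ⟨t, hts, htf, hcov⟩ := finite_approx_of_totallyBounded hS ε hε
  let idx : ((EuclideanSpace ℝ (Fin 3)) →L[ℝ] (EuclideanSpace ℝ (Fin 3))) → ℕ := fun y => if h : y ∈ Set.range f then Classical.choose h else 0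
  have hidx : ∀ y ∈ t, f (idx y) = y := fun y hy => by
    have h : y ∈ Set.range f := hts hy
    simp only [idx, dif_pos h]
    exact Classical.choose_spec h
  refine ⟨htf.toFinset.sup idx, fun k₀ _ => ?_⟩
  have hk : f k₀ ∈ ⋃ y ∈ t, ball y ε := hcov ⟨k₀, rfl⟩
  obtain ⟨y, hy, hdist⟩ := mem_iUnion₂.1 hk
  have hle : idx y ≤ htf.toFinset.sup idx := Finset.le_sup (htf.mem_toFinset.2 hy)
  -- `idx y ≤ k₀`? If not, the return is found below `k₀` anyway; we use `k = k₀ - idx y`.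
  by_cases hyk : idx y ≤ k₀
  · refine ⟨k₀ - idx y, by omega, Nat.sub_le _ _, ?_⟩
    have e : k₀ = idx y + (k₀ - idx y) := by omega
    rw [mem_ball, dist_eq_norm, ← hidx y hy] at hdist
    have h2 : ‖f k₀ - f (idx y)‖ = ‖(L.toLinearIsometry ^ (k₀ - idx y)).toContinuousLinearMap - 1‖ := by
      simp only [hf]
      conv_lhs => rw [e]
      exact norm_toCLM_pow_add_sub L (idx y) (k₀ - idx y)
    rwa [h2] at hdist
  · -- `k₀ < idx y ≤ M`: take `k = 0`
    refine ⟨0, by omega, Nat.zero_le _, ?_⟩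
    have h0 : (L.toLinearIsometry ^ (0 : ℕ)).toContinuousLinearMap = (1 : (EuclideanSpace ℝ (Fin 3)) →L[ℝ] (EuclideanSpace ℝ (Fin 3))) := by
      ext1 x; simp
    rw [h0, sub_self, norm_zero]
    exact hε

/-- **Good exponents along a divergent sequence of scales**: if `λ_n → ∞` and `θ > 0`, there
are `k_n ∈ ℕ` with `k_n/λ_n → θ` and `L^{k_n} → 1` (the best return in the window
`[⌊θλ_n⌋ − ⌊√λ_n⌋, ⌊θλ_n⌋]`, whose length tends to infinity but is `o(λ_n)`). [folklore] -/
theorem exists_good_exponents (L : (EuclideanSpace ℝ (Fin 3)) ≃ₗᵢ[ℝ] (EuclideanSpace ℝ (Fin 3))) {lam : ℕ → ℝ} (hlam : Tendsto lam atTop atTop)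
    {θ : ℝ} (hθ : 0 < θ) :
    ∃ k : ℕ → ℕ, Tendsto (fun n => (k n : ℝ) / lam n) atTop (𝓝 θ) ∧
      Tendsto (fun n => ‖(L.toLinearIsometry ^ (k n)).toContinuousLinearMap - 1‖) atTop (𝓝 0) := by
  classical
  set δ : ℕ → ℝ := fun j => ‖(L.toLinearIsometry ^ j).toContinuousLinearMap - 1‖ with hδ
  set W : ℕ → ℕ := fun n => ⌊Real.sqrt (lam n)⌋₊ with hW
  set k₀ : ℕ → ℕ := fun n => ⌊θ * lam n⌋₊ with hk₀
  -- the best return in the window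
  have hne : ∀ n, (Finset.Icc (k₀ n - W n) (k₀ n)).Nonempty := fun n =>
    ⟨k₀ n, Finset.mem_Icc.2 ⟨Nat.sub_le _ _, le_rfl⟩⟩
  choose k hkmem hkmin using fun n => Finset.exists_min_image (Finset.Icc (k₀ n - W n) (k₀ n)) δ (hne n)
  have hkI : ∀ n, k₀ n - W n ≤ k n ∧ k n ≤ k₀ n := fun n => Finset.mem_Icc.1 (hkmem n)
  refine ⟨k, ?_, ?_⟩
  · -- `k_n / λ_n → θ`
    have hlam0 : ∀ᶠ n in atTop, 1 ≤ lam n := hlam.eventually_ge_atTop 1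
    have hup : ∀ᶠ n in atTop, (k n : ℝ) / lam n ≤ θ := by
      filter_upwards [hlam0] with n hn
      have hl : 0 < lam n := by linarith
      rw [div_le_iff₀ hl]
      calc (k n : ℝ) ≤ k₀ n := by exact_mod_cast (hkI n).2
        _ ≤ θ * lam n := Nat.floor_le (by positivity)
    have hlow : ∀ᶠ n in atTop, θ - (Real.sqrt (lam n) + 1) / lam n ≤ (k n : ℝ) / lam n := by
      filter_upwards [hlam0] with n hn
      have hl : 0 < lam n := by linarith
      rw [sub_le_iff_le_add, ← add_div, le_div_iff₀ hl]
      have h1 : (θ * lam n : ℝ) < k₀ n + 1 := Nat.lt_floor_add_one _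
      have h2 : (k₀ n : ℝ) - W n ≤ k n := by
        have := (hkI n).1
        have h3 : (k₀ n : ℝ) - (W n : ℝ) ≤ ((k₀ n - W n : ℕ) : ℝ) := by
          rw [sub_le_iff_le_add]; exact_mod_cast le_tsub_add
        exact h3.trans (by exact_mod_cast this)
      have h4 : (W n : ℝ) ≤ Real.sqrt (lam n) := Nat.floor_le (Real.sqrt_nonneg _)
      linarith
    have hlim : Tendsto (fun n => θ - (Real.sqrt (lam n) + 1) / lam n) atTop (𝓝 θ) := by
      have h1 : Tendsto (fun n => (Real.sqrt (lam n) + 1) / lam n) atTop (𝓝 0) := by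
        have hs : Tendsto (fun n => Real.sqrt (lam n)) atTop atTop := Real.tendsto_sqrt_atTop.comp hlam
        have e : ∀ᶠ n in atTop, (Real.sqrt (lam n) + 1) / lam n =
            (Real.sqrt (lam n))⁻¹ + (lam n)⁻¹ := by
          filter_upwards [hlam0] with n hn
          have hl : 0 < lam n := by linarith
          have hsq : Real.sqrt (lam n) * Real.sqrt (lam n) = lam n := Real.mul_self_sqrt hl.le
          have hs0 : 0 < Real.sqrt (lam n) := Real.sqrt_pos.2 hl
          field_simp
          nlinarith [hsq]
        rw [tendsto_congr' e]
        simpa using hs.inv_tendsto_atTop.add hlam.inv_tendsto_atTop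
      simpa using (tendsto_const_nhds (x := θ)).sub h1
    exact tendsto_of_tendsto_of_tendsto_of_le_of_le' hlim tendsto_const_nhds hlow hup
  · -- `‖L^{k_n} − 1‖ → 0`
    rw [Metric.tendsto_atTop]
    intro ε hε
    obtain ⟨M, hM⟩ := exists_syndetic_return L hε
    have hWinf : Tendsto (fun n => (W n : ℝ)) atTop atTop := by
      have hs : Tendsto (fun n => Real.sqrt (lam n) - 1) atTop atTop :=
        tendsto_atTop_add_const_right _ (-1) (Real.tendsto_sqrt_atTop.comp hlam)
      refine tendsto_atTop_mono (fun n => ?_) hs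
      exact (Nat.sub_one_lt_floor _).le
    have hk₀inf : Tendsto (fun n => (k₀ n : ℝ)) atTop atTop := by
      have hs : Tendsto (fun n => θ * lam n - 1) atTop atTop :=
        tendsto_atTop_add_const_right _ (-1) (hlam.const_mul_atTop hθ)
      refine tendsto_atTop_mono (fun n => ?_) hs
      exact (Nat.sub_one_lt_floor _).le
    obtain ⟨N₁, hN₁⟩ := (tendsto_atTop_atTop.1 hWinf) M
    obtain ⟨N₂, hN₂⟩ := (tendsto_atTop_atTop.1 hk₀inf) M
    refine ⟨max N₁ N₂, fun n hn => ?_⟩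
    have hWn : M ≤ W n := by exact_mod_cast hN₁ n (le_of_max_le_left hn)
    have hk₀n : M ≤ k₀ n := by exact_mod_cast hN₂ n (le_of_max_le_right hn)
    obtain ⟨j, hj1, hj2, hj3⟩ := hM (k₀ n) hk₀n
    have hjmem : j ∈ Finset.Icc (k₀ n - W n) (k₀ n) := Finset.mem_Icc.2 ⟨by omega, hj2⟩
    have hmin := hkmin n j hjmem
    rw [dist_zero_right, Real.norm_of_nonneg (norm_nonneg _)]
    exact lt_of_le_of_lt hmin hj3

/-! ### Iterating a screw symmetry with offset -/

/-- **Iterated screw symmetry.** If a slice `v : (EuclideanSpace ℝ (Fin 3)) → (EuclideanSpace ℝ (Fin 3))` satisfies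
`v (L y + (L q − q) + β • b) = L (v y)` for all `y`, with `L b = b`, then
`v (L^k y + (L^k q − q) + (k β) • b) = L^k (v y)` for all `k` (telescoping sum
`Σ_{j<k} L^j (L q − q) = L^k q − q`). [folklore] -/
theorem iterate_screw_symmetry (L : (EuclideanSpace ℝ (Fin 3)) ≃ₗᵢ[ℝ] (EuclideanSpace ℝ (Fin 3))) {b q : (EuclideanSpace ℝ (Fin 3))} {β : ℝ} (hLb : L b = b)
    {v : (EuclideanSpace ℝ (Fin 3)) → (EuclideanSpace ℝ (Fin 3))} (hv : ∀ y, v (L y + (L q - q) + β • b) = L (v y)) :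
    ∀ (k : ℕ) (y : (EuclideanSpace ℝ (Fin 3))), v ((⇑L)^[k] y + ((⇑L)^[k] q - q) + ((k : ℝ) * β) • b) = (⇑L)^[k] (v y) := by
  intro k
  induction k with
  | zero => intro y; simp
  | succ k ih =>
    intro y
    have e : (⇑L)^[k + 1] y + ((⇑L)^[k + 1] q - q) + (((k + 1 : ℕ) : ℝ) * β) • b =
        L ((⇑L)^[k] y + ((⇑L)^[k] q - q) + ((k : ℝ) * β) • b) + (L q - q) + β • b := by
      rw [map_add, map_add, map_sub, L.map_smul, hLb, Function.iterate_succ_apply',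
        Function.iterate_succ_apply']
      push_cast
      rw [add_mul, one_mul, add_smul]
      abel
    rw [e, hv, ih, Function.iterate_succ_apply']

end Summit.NavierStokesRegularity.NavierStokesRegularity.Theorems.ScrewSymmetricLiouville

end
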